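import Mathlib
import Summits.Ventures.PercRepro2.HCov
import Summits.Ventures.PercRepro2.HCovCard5
import Summits.Ventures.PercRepro2.CycleArcs

/-!
# (HCOV) on every cycle (blind cell PercRepro2, typer-1 g48)

THEOREM CYC of LEAD-CYCLES.md §1 in the kernel: for the `n`-cycle `cycN n` (`V = E = Fin n`), every
admissible weight vector and every placement of the five distinct marks, `(HCOV)` holds
(**`HCov_cycle`**), and with it the crux of record `ZDelta` under `P(a₁ ↔ b) ≤ P(a₂ ↔ b)`
(**`ZDelta_cycle`**).

Proof.  Sort the marks (`Finset.orderEmbOfFin`): the mark connectivities of the cycle under `ω`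
are those of `C₅` under the arc pattern `arcOpen ω` (`conn_marks_iff`), whose law is the product
law of the arc weights `arcProb` (`prob_arcOpen_preimage`); so the covariance form transports,
`Gc p (cycN n) o a₁ a₂ a₃ b = Gc (arcProb p) (cycN 5) k_o k₁ k₂ k₃ k_b` (**`Gc_transport'`**, the
cross-type form of `RECM.Gc_transport`), and on `C₅` it is nonnegative for every weight vector by
the `K₅` certificate (`Cycle5.HCov_cycle5` of `HCovCard5.lean`).  No closed forms, no new `decide`.
-/

namespace Summit.Ventures.PercRepro2

namespace Cycle

variable {n : ℕ} [NeZero n]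

/-! ## Transport of the covariance form across vertex and edge types -/

section Transport

open CovForm

variable {V : Type*} {E : Type*} {V' : Type*} {E' : Type*} [Fintype E] [DecidableEq E]
  [Fintype E'] [DecidableEq E'] {R : Type*} [Field R]

omit [NeZero n] [Fintype E] [DecidableEq E] [Fintype E'] [DecidableEq E'] in
/-- The preimage of a connection event under a configuration map transporting connectivity. -/
lemma preimage_connEvent' {ends : E → Sym2 V} {ends' : E' → Sym2 V'} {Ψ : Config E' → Config E}
    {φ : V → V'} (hH : ∀ ω x z, Conn ends (Ψ ω) x z ↔ Conn ends' ω (φ x) (φ z)) (x z : V) :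
    Ψ ⁻¹' connEvent ends x z = connEvent ends' (φ x) (φ z) := by
  ext ω
  simp [hH]

omit [NeZero n] [Fintype E] [DecidableEq E] [Fintype E'] [DecidableEq E'] in
/-- The preimage of a one-point avoidance event under a configuration map transporting
connectivity. -/
lemma preimage_avoidAll_singleton' {ends : E → Sym2 V} {ends' : E' → Sym2 V'}
    {Ψ : Config E' → Config E} {φ : V → V'}
    (hH : ∀ ω x z, Conn ends (Ψ ω) x z ↔ Conn ends' ω (φ x) (φ z)) (s x : V) :
    Ψ ⁻¹' avoidAll ends s {x} = avoidAll ends' (φ s) {φ x} := by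
  ext ω
  simp [avoidAll, hH]

omit [NeZero n] [Fintype E] [DecidableEq E] [Fintype E'] [DecidableEq E'] in
/-- The preimage of `PDEvent`. -/
lemma preimage_PDEvent' {ends : E → Sym2 V} {ends' : E' → Sym2 V'} {Ψ : Config E' → Config E}
    {φ : V → V'} (hH : ∀ ω x z, Conn ends (Ψ ω) x z ↔ Conn ends' ω (φ x) (φ z)) (a₁ a₂ a₃ : V) :
    Ψ ⁻¹' PDEvent ends a₁ a₂ a₃ = PDEvent ends' (φ a₁) (φ a₂) (φ a₃) := by
  simp only [PDEvent, Dtilde, UnionCluster.inU, Set.preimage_inter, Set.preimage_compl,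
    Set.preimage_union, preimage_connEvent' hH]

omit [NeZero n] [Fintype E] [DecidableEq E] [Fintype E'] [DecidableEq E'] in
/-- The preimage of `TEvent`. -/
lemma preimage_TEvent' {ends : E → Sym2 V} {ends' : E' → Sym2 V'} {Ψ : Config E' → Config E}
    {φ : V → V'} (hH : ∀ ω x z, Conn ends (Ψ ω) x z ↔ Conn ends' ω (φ x) (φ z)) (a₁ a₂ a₃ : V) :
    Ψ ⁻¹' TEvent ends a₁ a₂ a₃ = TEvent ends' (φ a₁) (φ a₂) (φ a₃) := by
  simp only [TEvent, Set.preimage_inter, Set.preimage_compl, preimage_connEvent' hH]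

omit [NeZero n] in
/-- **Transport of the covariance form across types**: if `P_q(A) = P_p(Ψ⁻¹ A)` for every event
and `Ψ` carries `Conn ends` to `Conn ends'` along the vertex map `φ`, then `Gc` is carried along
(the same-type `RECM.Gc_transport` of `GcTransport.lean` with two vertex and two edge types). -/
theorem Gc_transport' {q : E → R} {p : E' → R} {ends : E → Sym2 V} {ends' : E' → Sym2 V'}
    {Ψ : Config E' → Config E} {φ : V → V'}
    (hP : ∀ A : Set (Config E), prob q A = prob p (Ψ ⁻¹' A))
    (hH : ∀ ω x z, Conn ends (Ψ ω) x z ↔ Conn ends' ω (φ x) (φ z)) (o a₁ a₂ a₃ b : V) :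
    Gc q ends o a₁ a₂ a₃ b = Gc p ends' (φ o) (φ a₁) (φ a₂) (φ a₃) (φ b) := by
  simp only [Gc, DEF, EQbo, EQb3, EQb3o, EQo, EQ3, EQ3o, PDb, PDbo, Do, gap, hP,
    Set.preimage_inter, preimage_PDEvent' hH, preimage_TEvent' hH, preimage_connEvent' hH,
    preimage_avoidAll_singleton' hH]

end Transport

/-! ## (HCOV) on every cycle -/

section Theorem

variable {R : Type*} [Field R] [LinearOrder R] [IsStrictOrderedRing R]

/-- The five marks of a cycle instance as a finset. -/
def marks (o a₁ a₂ a₃ b : Fin n) : Finset (Fin n) := {o, a₁, a₂, a₃, b}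

omit [NeZero n] in
/-- Five distinct marks are five points. -/
lemma card_marks (o a₁ a₂ a₃ b : Fin n) (h01 : o ≠ a₁) (h02 : o ≠ a₂) (h03 : o ≠ a₃)
    (h04 : o ≠ b) (h12 : a₁ ≠ a₂) (h13 : a₁ ≠ a₃) (h14 : a₁ ≠ b) (h23 : a₂ ≠ a₃) (h24 : a₂ ≠ b)
    (h34 : a₃ ≠ b) : (marks o a₁ a₂ a₃ b).card = 5 := by
  unfold marks
  rw [Finset.card_insert_of_notMem (by simp [h01, h02, h03, h04]),
    Finset.card_insert_of_notMem (by simp [h12, h13, h14]),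
    Finset.card_insert_of_notMem (by simp [h23, h24]),
    Finset.card_insert_of_notMem (by simp [h34]), Finset.card_singleton]

omit [NeZero n] in
/-- Every mark is a sorted mark. -/
lemma exists_orderEmb_eq {M : Finset (Fin n)} (hM : M.card = 5) {x : Fin n} (hx : x ∈ M) :
    ∃ k : Fin 5, M.orderEmbOfFin hM k = x := by
  have h := Finset.range_orderEmbOfFin M hM
  rw [← Finset.mem_coe, ← h] at hx
  exact hx

/-- **(HCOV) on the `n`-cycle for every admissible weight vector and every placement of the five
distinct marks** (THEOREM CYC of LEAD-CYCLES.md §1, in the kernel): the mark connectivities of the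
cycle are those of `C₅` with the independent arc weights `arcProb` (`conn_marks_iff`,
`prob_arcOpen_preimage`), so `Gc` transports to `C₅` (`Gc_transport'`), where it is nonnegative by
the `K₅` certificate (`Cycle5.HCov_cycle5`). -/
theorem HCov_cycle (p : Fin n → R) (hp : IsProbVec p) (o a₁ a₂ a₃ b : Fin n) (h01 : o ≠ a₁)
    (h02 : o ≠ a₂) (h03 : o ≠ a₃) (h04 : o ≠ b) (h12 : a₁ ≠ a₂) (h13 : a₁ ≠ a₃) (h14 : a₁ ≠ b)
    (h23 : a₂ ≠ a₃) (h24 : a₂ ≠ b) (h34 : a₃ ≠ b) : CovForm.HCov p (cycN n) o a₁ a₂ a₃ b := by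
  have hM := card_marks o a₁ a₂ a₃ b h01 h02 h03 h04 h12 h13 h14 h23 h24 h34
  set qe := (marks o a₁ a₂ a₃ b).orderEmbOfFin hM with hqe
  have hq : StrictMono (⇑qe) := qe.strictMono
  obtain ⟨ko, hko⟩ := exists_orderEmb_eq hM (x := o) (by simp [marks])
  obtain ⟨k₁, hk₁⟩ := exists_orderEmb_eq hM (x := a₁) (by simp [marks])
  obtain ⟨k₂, hk₂⟩ := exists_orderEmb_eq hM (x := a₂) (by simp [marks])
  obtain ⟨k₃, hk₃⟩ := exists_orderEmb_eq hM (x := a₃) (by simp [marks])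
  obtain ⟨kb, hkb⟩ := exists_orderEmb_eq hM (x := b) (by simp [marks])
  rw [← hqe] at hko hk₁ hk₂ hk₃ hkb
  have key : CovForm.Gc (arcProb (⇑qe) p) (cycN 5) ko k₁ k₂ k₃ kb =
      CovForm.Gc p (cycN n) o a₁ a₂ a₃ b := by
    rw [← hko, ← hk₁, ← hk₂, ← hk₃, ← hkb]
    exact Gc_transport' (fun A => (prob_arcOpen_preimage hq p A).symm)
      (fun ω x z => (conn_marks_iff hq ω x z).symm) ko k₁ k₂ k₃ kb
  have d01 : ko ≠ k₁ := fun h => h01 (by rw [← hko, ← hk₁, h])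
  have d02 : ko ≠ k₂ := fun h => h02 (by rw [← hko, ← hk₂, h])
  have d03 : ko ≠ k₃ := fun h => h03 (by rw [← hko, ← hk₃, h])
  have d04 : ko ≠ kb := fun h => h04 (by rw [← hko, ← hkb, h])
  have d12 : k₁ ≠ k₂ := fun h => h12 (by rw [← hk₁, ← hk₂, h])
  have d13 : k₁ ≠ k₃ := fun h => h13 (by rw [← hk₁, ← hk₃, h])
  have d14 : k₁ ≠ kb := fun h => h14 (by rw [← hk₁, ← hkb, h])
  have d23 : k₂ ≠ k₃ := fun h => h23 (by rw [← hk₂, ← hk₃, h])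
  have d24 : k₂ ≠ kb := fun h => h24 (by rw [← hk₂, ← hkb, h])
  have d34 : k₃ ≠ kb := fun h => h34 (by rw [← hk₃, ← hkb, h])
  unfold CovForm.HCov
  rw [← key]
  exact Cycle5.HCov_cycle5 (arcProb (⇑qe) p) (isProbVec_arcProb (⇑qe) hp) ko k₁ k₂ k₃ kb
    d01 d02 d03 d04 d12 d13 d14 d23 d24 d34

/-- **The crux of record on every cycle**: `ZDelta` for every admissible weight vector with
`P(a₁ ↔ b) ≤ P(a₂ ↔ b)`, every placement of the five distinct marks. -/
theorem ZDelta_cycle (p : Fin n → R) (hp : IsProbVec p) (o a₁ a₂ a₃ b : Fin n) (h01 : o ≠ a₁)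
    (h02 : o ≠ a₂) (h03 : o ≠ a₃) (h04 : o ≠ b) (h12 : a₁ ≠ a₂) (h13 : a₁ ≠ a₃) (h14 : a₁ ≠ b)
    (h23 : a₂ ≠ a₃) (h24 : a₂ ≠ b) (h34 : a₃ ≠ b)
    (hord : prob p (connEvent (cycN n) a₁ b) ≤ prob p (connEvent (cycN n) a₂ b)) :
    ZDelta p (cycN n) o a₁ a₂ a₃ b :=
  CovForm.ZDelta_of_HCov p hp (cycN n) hord
    (HCov_cycle p hp o a₁ a₂ a₃ b h01 h02 h03 h04 h12 h13 h14 h23 h24 h34)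

end Theorem

end Cycle

end Summit.Ventures.PercRepro2
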